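import Mathlib
import Summits.KontsevichZagierPeriods.KontsevichZagierPeriods.Theorems.InverseLandauTateLiftingAffineChart
import Summits.KontsevichZagierPeriods.KontsevichZagierPeriods.Theorems.InverseLandauTateLiftingSimplexChart
import Summits.KontsevichZagierPeriods.KontsevichZagierPeriods.Theorems.InverseLandauTateLiftingSimplexHull
import Summits.KontsevichZagierPeriods.KontsevichZagierPeriods.Theorems.InverseLandauTateLiftingFubiniReduction
import Summits.KontsevichZagierPeriods.KontsevichZagierPeriods.Theorems.InverseLandauTateLiftingLowDimAlgSector
import Summits.KontsevichZagierPeriods.KontsevichZagierPeriods.Theorems.InverseLandauTateLiftingGenusZeroSector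
import Literature.NumberTheory.Transcendental.KZSemiCanonicalReductionProofs
import Literature.NumberTheory.Transcendental.GenusZeroPeriodsMZVProofs

/-!
# `TateLifting` (stmt-KontsevichZagierPeriods-9129), line `Sketch` — THE POLYTOPE SECTOR
# (Hilbert's third problem has no obstruction in the Kontsevich–Zagier calculus)

Assembly of stubs 50–52 of the line (`tateLifting_affineChart`, `tateLifting_simplexChart`,
`tateLifting_simplexHull`) with the landed Fubini / low-dimensional sectors. A SIMPLEX REPRESENTATION is an
honest integral representation whose domain is an affine image `A(Δ_n) + b` of the open ordered simplex
`KZ.openOrderedSimplex n = {1 > x₀ > ⋯ > x_{n−1} > 0}` (`A`, `b` with real-algebraic entries, `det A ≠ 0`;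
equivalently — `tateLifting_simplexHull` — the interior of the convex hull of `n + 1` affinely independent
points with real-algebraic coordinates) and whose integrand is a polynomial over `K = ℚ̄ ∩ ℝ`
(`algebraicClosure ℚ ℝ`), in any dimension `n`.

* `Polytope.simplex_toPoint` — every simplex representation differs by KZ relations from a representation
  over the point `ℝ⁰`: the affine move (rule 2, constant Jacobian `|det A|`), the cubical chart of the
  ordered simplex (rule 2, Jacobian `∏ tᵢ^{n−1−i}`), then the landed cube-to-point reduction
  `Fubini.cubePoly_toPoint` (cylinder Stokes steps, rule 3).
* `simplexKernel` — **KZ's Conjecture 1 (kernel form) on the subgroup generated by all simplex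
  representations of all dimensions and all representations over `ℝ⁰`**: every vanishing `ℤ`-combination
  is a relation (landed dimension-zero kernel `kzKernelConjecture_lowDimAlg`; no transcendence input beyond
  it — the values are real algebraic numbers).
* `kzPeriodConjecture_polytope` — **two representations of ANY two dimensions, each covered up to null
  sets by finitely many pairwise almost-disjoint simplex representations (e.g. POLYTOPES with real-algebraic
  vertices and integrand `1`), with the same value are KZ-equivalent.** Volume is the only invariant: the
  Dehn invariant of Hilbert's third problem (Dehn 1901; Sydler 1965) is invisible to the four moves,
  because the Newton–Leibniz move changes dimension. (Contrast: route ScissorsTransport's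
  `PolytopeTransport`, stmt-KontsevichZagierPeriods-10815, asks for ONE rule-(2) move and is not claimed.)
* `hullKernel`, `kzPeriodConjecture_hull` — the same with domains `interior (convexHull ℝ (range v))`.
* `TateLifting_polytopeSector` — the crux `TateLifting` on this sector (`relations ≤ relations ⊔ closure T`).

Design: no definitions (generator classes are written out in the statements). References: M. Kontsevich,
D. Zagier, *Periods* (2001), §1.2; M. Dehn, *Über den Rauminhalt*, Math. Ann. 55 (1901); J.-P. Sydler,
Comment. Math. Helv. 40 (1965).
-/

noncomputable section

namespace Summit.KontsevichZagierPeriods.InverseLandau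

open MeasureTheory Set
open Literature.NumberTheory.Transcendental

namespace Polytope

/-- **Every simplex representation is a polynomial cube modulo relations**: the affine move to the ordered
simplex (`tateLifting_affineChart`), then the cubical chart (`tateLifting_simplexChart`).
[cite: KontsevichZagier2001, §1.2 rule (2)] -/
theorem simplex_toCube {n : ℕ} (A : Matrix (Fin n) (Fin n) ℝ) (b : Fin n → ℝ)
    (P : MvPolynomial (Fin n) (algebraicClosure ℚ ℝ)) (r : KZ.IntegralRep n)
    (hAa : ∀ i j, IsAlgebraic ℚ (A i j)) (hba : ∀ i, IsAlgebraic ℚ (b i)) (hdet : A.det ≠ 0)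
    (hdom : r.domain = (fun x => A.mulVec x + b) '' KZ.openOrderedSimplex n)
    (hint : Set.EqOn r.integrand (fun z => (MvPolynomial.aeval z P : ℝ)) r.domain) :
    ∃ (P' : MvPolynomial (Fin n) (algebraicClosure ℚ ℝ)) (r' : KZ.IntegralRep n),
      r'.domain = Set.pi Set.univ (fun _ => Set.Ioo (0 : ℝ) 1) ∧
      Set.EqOn r'.integrand (fun z => (MvPolynomial.aeval z P' : ℝ)) r'.domain ∧
      KZ.of r - KZ.of r' ∈ KZ.relations := by
  obtain ⟨hdetalg, hmove, hpoly⟩ := tateLifting_affineChart n A b hAa hba hdet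
  obtain ⟨r₁, hd₁, hi₁, hrel₁⟩ := hmove r
  have habs : IsAlgebraic ℚ |A.det| := by
    rcases abs_choice A.det with h | h
    · rw [h]; exact hdetalg
    · rw [h]; exact hdetalg.neg
  obtain ⟨P₁, hP₁⟩ := hpoly |A.det| P habs
  have hinj : Function.Injective (fun x => A.mulVec x + b) := by
    intro x y hxy
    have h : A.mulVec x = A.mulVec y := add_right_cancel hxy
    exact (Matrix.mulVec_injective_iff_isUnit.mpr ((Matrix.isUnit_iff_isUnit_det A).mpr hdet.isUnit)) h
  have hdom₁ : r₁.domain = KZ.openOrderedSimplex n := by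
    rw [hd₁, hdom]
    exact hinj.preimage_image _
  obtain ⟨hmove₂, hpoly₂⟩ := tateLifting_simplexChart n
  obtain ⟨r₂, hd₂, hi₂, hrel₂⟩ := hmove₂ r₁ hdom₁
  obtain ⟨P₂, hP₂⟩ := hpoly₂ P₁
  refine ⟨P₂, r₂, hd₂, fun x hx => ?_, ?_⟩
  · have hx' : (fun i => ∏ j ∈ Finset.Iic i, x j) ∈ KZ.openOrderedSimplex n := by
      refine Hyperlog.φc_mem_simplex (ℓ := n) (x := x) ?_
      rw [hd₂] at hx
      exact fun i => Set.mem_univ_pi.mp hx i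
    have hmem : A.mulVec (fun i => ∏ j ∈ Finset.Iic i, x j) + b ∈ r.domain := by
      rw [hdom]
      exact Set.mem_image_of_mem _ hx'
    show r₂.integrand x = MvPolynomial.aeval x P₂
    rw [hP₂ x, hi₂]
    show (∏ i : Fin n, ∏ k ∈ Finset.Iio i, x k) * r₁.integrand (fun i => ∏ j ∈ Finset.Iic i, x j) = _
    rw [hi₁]
    show (∏ i : Fin n, ∏ k ∈ Finset.Iio i, x k) *
        (|A.det| * r.integrand (A.mulVec (fun i => ∏ j ∈ Finset.Iic i, x j) + b)) = _
    rw [hint hmem, hP₁]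
  · have : KZ.of r - KZ.of r₂ = (KZ.of r - KZ.of r₁) + (KZ.of r₁ - KZ.of r₂) := by abel
    rw [this]
    exact KZ.relations.add_mem hrel₁ hrel₂

/-- **Every simplex representation differs by relations from a representation over the point `ℝ⁰`**
(`simplex_toCube` + the landed cube-to-point reduction `Fubini.cubePoly_toPoint`).
[cite: KontsevichZagier2001, §1.2] -/
theorem simplex_toPoint {n : ℕ} (A : Matrix (Fin n) (Fin n) ℝ) (b : Fin n → ℝ)
    (P : MvPolynomial (Fin n) (algebraicClosure ℚ ℝ)) (r : KZ.IntegralRep n)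
    (hAa : ∀ i j, IsAlgebraic ℚ (A i j)) (hba : ∀ i, IsAlgebraic ℚ (b i)) (hdet : A.det ≠ 0)
    (hdom : r.domain = (fun x => A.mulVec x + b) '' KZ.openOrderedSimplex n)
    (hint : Set.EqOn r.integrand (fun z => (MvPolynomial.aeval z P : ℝ)) r.domain) :
    ∃ r₀ : KZ.IntegralRep 0, KZ.of r - KZ.of r₀ ∈ KZ.relations := by
  obtain ⟨P', r', hd', hi', hrel⟩ := simplex_toCube A b P r hAa hba hdet hdom hint
  obtain ⟨r₀, _, hrel₀⟩ := Fubini.cubePoly_toPoint n P' r' hd' hi'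
  refine ⟨r₀, ?_⟩
  have : KZ.of r - KZ.of r₀ = (KZ.of r - KZ.of r') + (KZ.of r' - KZ.of r₀) := by abel
  rw [this]
  exact KZ.relations.add_mem hrel hrel₀

/-- **A representation covered by simplex representations reduces to points modulo relations**: iterated
domain additivity over the almost-partition (`KZ.of_sub_sum_of_mem_relations`), then `simplex_toPoint`
piecewise. [cite: KontsevichZagier2001, §1.2 rule (1)] -/
theorem covered_reduce {L : ℕ} {α : Type*} (u : Finset α) (ρ : KZ.IntegralRep L) (Q : α → KZ.IntegralRep L)
    (h1 : ∀ i ∈ u, volume ((Q i).domain \ ρ.domain) = 0)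
    (h2 : ∀ i ∈ u, Set.EqOn (Q i).integrand ρ.integrand ((Q i).domain ∩ ρ.domain))
    (h3 : volume (ρ.domain \ ⋃ i ∈ u, (Q i).domain) = 0)
    (h4 : (u : Set α).Pairwise (fun i j => volume ((Q i).domain ∩ (Q j).domain) = 0))
    (h5 : ∀ i ∈ u, ∃ (A : Matrix (Fin L) (Fin L) ℝ) (b : Fin L → ℝ)
      (P : MvPolynomial (Fin L) (algebraicClosure ℚ ℝ)),
      (∀ a c, IsAlgebraic ℚ (A a c)) ∧ (∀ a, IsAlgebraic ℚ (b a)) ∧ A.det ≠ 0 ∧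
      (Q i).domain = (fun x => A.mulVec x + b) '' KZ.openOrderedSimplex L ∧
      Set.EqOn (Q i).integrand (fun z => (MvPolynomial.aeval z P : ℝ)) (Q i).domain) :
    ∃ ℓ ∈ AddSubgroup.closure {d : KZ.FormalRep | ∃ r : KZ.IntegralRep 0, d = KZ.of r},
      KZ.of ρ - ℓ ∈ KZ.relations := by
  classical
  have hred : ∀ i ∈ u, ∃ ℓ ∈ AddSubgroup.closure {d : KZ.FormalRep | ∃ r : KZ.IntegralRep 0, d = KZ.of r},
      KZ.of (Q i) - ℓ ∈ KZ.relations := by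
    intro i hi
    obtain ⟨A, b, P, hAa, hba, hdet, hdom, hint⟩ := h5 i hi
    obtain ⟨r₀, hrel⟩ := simplex_toPoint A b P (Q i) hAa hba hdet hdom hint
    exact ⟨KZ.of r₀, AddSubgroup.subset_closure ⟨r₀, rfl⟩, hrel⟩
  choose! ℓ hℓ hrelℓ using hred
  refine ⟨∑ i ∈ u, ℓ i, sum_mem fun i hi => hℓ i hi, ?_⟩
  have e : KZ.of ρ - ∑ i ∈ u, ℓ i =
      (KZ.of ρ - ∑ i ∈ u, KZ.of (Q i)) + ∑ i ∈ u, (KZ.of (Q i) - ℓ i) := by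
    rw [Finset.sum_sub_distrib]; abel
  rw [e]
  exact KZ.relations.add_mem (KZ.of_sub_sum_of_mem_relations u ρ Q h1 h2 h3 h4)
    (sum_mem fun i hi => hrelℓ i hi)

end Polytope

open Polytope

/-- **THE POLYTOPE SECTOR (kernel form of KZ's Conjecture 1).** Every vanishing `ℤ`-combination of
SIMPLEX REPRESENTATIONS — honest representations of any dimension `n` over an affine image `A(Δ_n) + b` of
the open ordered simplex (`A`, `b` real-algebraic, `det A ≠ 0`) with a `K`-polynomial integrand
(`K = algebraicClosure ℚ ℝ`) — and of representations over `ℝ⁰` is a relation of the Kontsevich–Zagier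
calculus. [cite: KontsevichZagier2001, §1.2] -/
theorem simplexKernel :
    ∀ c ∈ AddSubgroup.closure
        ({d : KZ.FormalRep | ∃ (n : ℕ) (A : Matrix (Fin n) (Fin n) ℝ) (b : Fin n → ℝ)
            (P : MvPolynomial (Fin n) (algebraicClosure ℚ ℝ)) (r : KZ.IntegralRep n),
          (∀ i j, IsAlgebraic ℚ (A i j)) ∧ (∀ i, IsAlgebraic ℚ (b i)) ∧ A.det ≠ 0 ∧
          r.domain = (fun x => A.mulVec x + b) '' KZ.openOrderedSimplex n ∧
          Set.EqOn r.integrand (fun z => (MvPolynomial.aeval z P : ℝ)) r.domain ∧ d = KZ.of r} ∪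
        {d : KZ.FormalRep | ∃ r : KZ.IntegralRep 0, d = KZ.of r}),
      KZ.eval c = 0 → c ∈ KZ.relations := by
  refine GenusZero.kernel_of_reduce (L := {d : KZ.FormalRep | (∃ r : KZ.IntegralRep 0, d = KZ.of r) ∨
      ∃ (r : KZ.IntegralRep 1) (p q : Polynomial ℝ), (∀ i, IsAlgebraic ℚ (p.coeff i)) ∧
        (∀ i, IsAlgebraic ℚ (q.coeff i)) ∧ (∀ x ∈ r.domain, q.eval (x 0) ≠ 0) ∧
        Set.EqOn r.integrand (fun x => p.eval (x 0) / q.eval (x 0)) r.domain ∧ d = KZ.of r}) ?_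
    kzKernelConjecture_lowDimAlg
  rintro d (⟨n, A, b, P, r, hAa, hba, hdet, hdom, hint, rfl⟩ | ⟨r, rfl⟩)
  · obtain ⟨r₀, hrel⟩ := simplex_toPoint A b P r hAa hba hdet hdom hint
    exact ⟨KZ.of r₀, AddSubgroup.subset_closure (Or.inl ⟨r₀, rfl⟩), hrel⟩
  · exact ⟨KZ.of r, AddSubgroup.subset_closure (Or.inl ⟨r, rfl⟩), by rw [sub_self]; exact KZ.relations.zero_mem⟩

/-- **Two simplex representations of ANY two dimensions with the same value are KZ-equivalent** (e.g. a cube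
and a regular tetrahedron of the same volume, once presented as simplices / points: no Dehn invariant).
[cite: KontsevichZagier2001, §1.2] -/
theorem kzPeriodConjecture_simplex {n m : ℕ} (r : KZ.IntegralRep n) (r' : KZ.IntegralRep m)
    (A : Matrix (Fin n) (Fin n) ℝ) (b : Fin n → ℝ) (P : MvPolynomial (Fin n) (algebraicClosure ℚ ℝ))
    (A' : Matrix (Fin m) (Fin m) ℝ) (b' : Fin m → ℝ) (P' : MvPolynomial (Fin m) (algebraicClosure ℚ ℝ))
    (hAa : ∀ i j, IsAlgebraic ℚ (A i j)) (hba : ∀ i, IsAlgebraic ℚ (b i)) (hdet : A.det ≠ 0)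
    (hdom : r.domain = (fun x => A.mulVec x + b) '' KZ.openOrderedSimplex n)
    (hint : Set.EqOn r.integrand (fun z => (MvPolynomial.aeval z P : ℝ)) r.domain)
    (hAa' : ∀ i j, IsAlgebraic ℚ (A' i j)) (hba' : ∀ i, IsAlgebraic ℚ (b' i)) (hdet' : A'.det ≠ 0)
    (hdom' : r'.domain = (fun x => A'.mulVec x + b') '' KZ.openOrderedSimplex m)
    (hint' : Set.EqOn r'.integrand (fun z => (MvPolynomial.aeval z P' : ℝ)) r'.domain)
    (hv : r.value = r'.value) : KZ.Equivalent r r' :=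
  Fubini.equivalent_of_kernel simplexKernel (Or.inl ⟨n, A, b, P, r, hAa, hba, hdet, hdom, hint, rfl⟩)
    (Or.inl ⟨m, A', b', P', r', hAa', hba', hdet', hdom', hint', rfl⟩) hv

/-- **KZ's CONJECTURE 1 FOR POLYTOPES OF ANY TWO DIMENSIONS.** Two representations, each covered up to null
sets by finitely many pairwise almost-disjoint simplex representations (real-algebraic vertices, `K`-polynomial
integrands — e.g. integrand `1`: polytopes with real-algebraic vertices, triangulated), with the same value are
KZ-equivalent (iterated domain additivity `KZ.of_sub_sum_of_mem_relations`, then `simplexKernel`). Volume is the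
only invariant; the Dehn invariant is invisible to the four moves. [cite: KontsevichZagier2001, §1.2] -/
theorem kzPeriodConjecture_polytope {N M : ℕ} {ι κ : Type*} (s : Finset ι) (t : Finset κ)
    (r : KZ.IntegralRep N) (R : ι → KZ.IntegralRep N) (r' : KZ.IntegralRep M) (R' : κ → KZ.IntegralRep M)
    (hsub : ∀ i ∈ s, volume ((R i).domain \ r.domain) = 0)
    (hint : ∀ i ∈ s, Set.EqOn (R i).integrand r.integrand ((R i).domain ∩ r.domain))
    (hcov : volume (r.domain \ ⋃ i ∈ s, (R i).domain) = 0)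
    (hdisj : (s : Set ι).Pairwise fun i j => volume ((R i).domain ∩ (R j).domain) = 0)
    (hgen : ∀ i ∈ s, ∃ (A : Matrix (Fin N) (Fin N) ℝ) (b : Fin N → ℝ)
      (P : MvPolynomial (Fin N) (algebraicClosure ℚ ℝ)),
      (∀ a c, IsAlgebraic ℚ (A a c)) ∧ (∀ a, IsAlgebraic ℚ (b a)) ∧ A.det ≠ 0 ∧
      (R i).domain = (fun x => A.mulVec x + b) '' KZ.openOrderedSimplex N ∧
      Set.EqOn (R i).integrand (fun z => (MvPolynomial.aeval z P : ℝ)) (R i).domain)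
    (hsub' : ∀ k ∈ t, volume ((R' k).domain \ r'.domain) = 0)
    (hint' : ∀ k ∈ t, Set.EqOn (R' k).integrand r'.integrand ((R' k).domain ∩ r'.domain))
    (hcov' : volume (r'.domain \ ⋃ k ∈ t, (R' k).domain) = 0)
    (hdisj' : (t : Set κ).Pairwise fun i j => volume ((R' i).domain ∩ (R' j).domain) = 0)
    (hgen' : ∀ k ∈ t, ∃ (A : Matrix (Fin M) (Fin M) ℝ) (b : Fin M → ℝ)
      (P : MvPolynomial (Fin M) (algebraicClosure ℚ ℝ)),
      (∀ a c, IsAlgebraic ℚ (A a c)) ∧ (∀ a, IsAlgebraic ℚ (b a)) ∧ A.det ≠ 0 ∧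
      (R' k).domain = (fun x => A.mulVec x + b) '' KZ.openOrderedSimplex M ∧
      Set.EqOn (R' k).integrand (fun z => (MvPolynomial.aeval z P : ℝ)) (R' k).domain)
    (hv : r.value = r'.value) : KZ.Equivalent r r' := by
  obtain ⟨ℓ, hℓ, hrel⟩ := covered_reduce s r R hsub hint hcov hdisj hgen
  obtain ⟨ℓ', hℓ', hrel'⟩ := covered_reduce t r' R' hsub' hint' hcov' hdisj' hgen'
  have hmem : ℓ - ℓ' ∈ AddSubgroup.closure
      {d : KZ.FormalRep | (∃ r : KZ.IntegralRep 0, d = KZ.of r) ∨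
        ∃ (r : KZ.IntegralRep 1) (p q : Polynomial ℝ), (∀ i, IsAlgebraic ℚ (p.coeff i)) ∧
          (∀ i, IsAlgebraic ℚ (q.coeff i)) ∧ (∀ x ∈ r.domain, q.eval (x 0) ≠ 0) ∧
          Set.EqOn r.integrand (fun x => p.eval (x 0) / q.eval (x 0)) r.domain ∧ d = KZ.of r} := by
    refine AddSubgroup.closure_mono (fun d hd => ?_) (sub_mem hℓ hℓ')
    exact Or.inl hd
  have hev : KZ.eval (ℓ - ℓ') = 0 := by
    have h1 := KZ.relations_le_ker_eval_holds hrel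
    have h2 := KZ.relations_le_ker_eval_holds hrel'
    rw [AddMonoidHom.mem_ker, map_sub, KZ.eval_of] at h1 h2
    rw [map_sub]
    change r.value = r'.value at hv
    linarith
  have hker := kzKernelConjecture_lowDimAlg _ hmem hev
  show KZ.of r - KZ.of r' ∈ KZ.relations
  have : KZ.of r - KZ.of r' = (KZ.of r - ℓ) + (ℓ - ℓ') - (KZ.of r' - ℓ') := by abel
  rw [this]
  exact KZ.relations.sub_mem (KZ.relations.add_mem hrel hker) hrel'

/-- **Conjecture 1 (kernel form) on CONVEX-HULL SIMPLICES**: the same as `simplexKernel` with domains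
`interior (convexHull ℝ (range v))` for affinely independent `v : Fin (n + 1) → ℝⁿ` with real-algebraic
coordinates (`tateLifting_simplexHull`). [cite: KontsevichZagier2001, §1.2] -/
theorem hullKernel :
    ∀ c ∈ AddSubgroup.closure
        ({d : KZ.FormalRep | ∃ (n : ℕ) (v : Fin (n + 1) → (Fin n → ℝ))
            (P : MvPolynomial (Fin n) (algebraicClosure ℚ ℝ)) (r : KZ.IntegralRep n),
          AffineIndependent ℝ v ∧ (∀ k i, IsAlgebraic ℚ (v k i)) ∧
          r.domain = interior (convexHull ℝ (Set.range v)) ∧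
          Set.EqOn r.integrand (fun z => (MvPolynomial.aeval z P : ℝ)) r.domain ∧ d = KZ.of r} ∪
        {d : KZ.FormalRep | ∃ r : KZ.IntegralRep 0, d = KZ.of r}),
      KZ.eval c = 0 → c ∈ KZ.relations := by
  intro c hc hev
  refine simplexKernel c (AddSubgroup.closure_mono (Set.union_subset_union_left _ ?_) hc) hev
  rintro d ⟨n, v, P, r, hv, halg, hdom, hint, rfl⟩
  obtain ⟨hdet, hhull⟩ := tateLifting_simplexHull n v hv
  refine ⟨n, Matrix.of fun i j : Fin n => v j.succ i - v (Fin.castSucc j) i, v 0, P, r,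
    fun i j => ?_, fun i => halg 0 i, hdet, by rw [hdom, hhull], hint, rfl⟩
  rw [Matrix.of_apply]
  exact (halg _ _).sub (halg _ _)

/-- **Two convex-hull simplices (real-algebraic vertices, `K`-polynomial integrands) of any two dimensions with
the same value are KZ-equivalent.** [cite: KontsevichZagier2001, §1.2] -/
theorem kzPeriodConjecture_hull {n m : ℕ} (r : KZ.IntegralRep n) (r' : KZ.IntegralRep m)
    (v : Fin (n + 1) → (Fin n → ℝ)) (P : MvPolynomial (Fin n) (algebraicClosure ℚ ℝ))
    (v' : Fin (m + 1) → (Fin m → ℝ)) (P' : MvPolynomial (Fin m) (algebraicClosure ℚ ℝ))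
    (hv : AffineIndependent ℝ v) (halg : ∀ k i, IsAlgebraic ℚ (v k i))
    (hdom : r.domain = interior (convexHull ℝ (Set.range v)))
    (hint : Set.EqOn r.integrand (fun z => (MvPolynomial.aeval z P : ℝ)) r.domain)
    (hv' : AffineIndependent ℝ v') (halg' : ∀ k i, IsAlgebraic ℚ (v' k i))
    (hdom' : r'.domain = interior (convexHull ℝ (Set.range v')))
    (hint' : Set.EqOn r'.integrand (fun z => (MvPolynomial.aeval z P' : ℝ)) r'.domain)
    (hval : r.value = r'.value) : KZ.Equivalent r r' :=
  Fubini.equivalent_of_kernel hullKernel (Or.inl ⟨n, v, P, r, hv, halg, hdom, hint, rfl⟩)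
    (Or.inl ⟨m, v', P', r', hv', halg', hdom', hint', rfl⟩) hval

/-- **The crux `TateLifting` on the polytope sector**: every vanishing combination of simplex representations
and points lies in `KZ.relations ⊔ closure T` for every `T` (in fact in `KZ.relations`).
[cite: KontsevichZagier2001, §1.2] -/
theorem TateLifting_polytopeSector (T : Set KZ.FormalRep) :
    ∀ c ∈ AddSubgroup.closure
        ({d : KZ.FormalRep | ∃ (n : ℕ) (A : Matrix (Fin n) (Fin n) ℝ) (b : Fin n → ℝ)
            (P : MvPolynomial (Fin n) (algebraicClosure ℚ ℝ)) (r : KZ.IntegralRep n),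
          (∀ i j, IsAlgebraic ℚ (A i j)) ∧ (∀ i, IsAlgebraic ℚ (b i)) ∧ A.det ≠ 0 ∧
          r.domain = (fun x => A.mulVec x + b) '' KZ.openOrderedSimplex n ∧
          Set.EqOn r.integrand (fun z => (MvPolynomial.aeval z P : ℝ)) r.domain ∧ d = KZ.of r} ∪
        {d : KZ.FormalRep | ∃ r : KZ.IntegralRep 0, d = KZ.of r}),
      KZ.eval c = 0 → c ∈ KZ.relations ⊔ AddSubgroup.closure T :=
  fun c hc hev => AddSubgroup.mem_sup_left (simplexKernel c hc hev)

end Summit.KontsevichZagierPeriods.InverseLandau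

end
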